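import Summits.CriticalPhenomena.SAWScalingLimit.Theorems.SAWDefectDecoherenceBoundaryClosureRZigzagDiscretisationCharts
import Literature.Probability.RandomPlanarGeometry.HexTipPattern
import HarnessLib

/-!
# Crux `BoundaryClosureR` (stmt-CriticalPhenomena-14004), line `polygon-parity-squeeze`,
# stub `stub_innerPolygonsOfZigzag` (7b): the six normal-direction lattice walks

Landing target:
`Summits/CriticalPhenomena/SAWScalingLimit/Theorems/SAWDefectDecoherenceBoundaryClosureRZigzagDiscretisationWalks.lean`
(`--supports stmt-CriticalPhenomena-14004`; building block of the registered stub
`stub_innerPolygonsOfZigzag`, the lattice half of the inner-polygon construction (IP)).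

To move a face of the hexagonal lattice `ℍ` INTO (or OUT OF) the inner polygon near a side or a
corner of form(s) `k, k'`, one walks along a lattice walk whose net direction is an inner normal
`n_j = innerNormal j` and along which the zigzag forms `zigzagForm i` of the three directions `i`
with `⟪n_i, n_j⟫ ≥ 1/2` never decrease (so that the exact thresholds `n ≤ zigzagForm i v` stay
satisfied).  This file constructs these six walks `zdWalk j v : ℕ → HexVertex` (4-periodic: from an
up face `(x;0)` one moves to the down face `(x - a;1)`, from a down face `(x;1)` to the up face
`(x + b;0)`, the cells `a, b ∈ {0, e₀, e₁}` being read from two tables indexed by `j` and a phase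
bit flipped at every up-move) and proves:

* `zdWalk_adj` — consecutive faces are adjacent in `ℍ`;
* `zigzagForm_le_zdWalk_succ` — the three forms `i` with `⟪n_j, n_i⟫ ≥ 1/2` are non-decreasing;
* `zdWalk_add_four`, `hexCenter_zdWalk_four_mul` — every period translates by the lattice vector
  `zdPeriod j` with `triEmbed (zdPeriod j) = √3·n_j`, so `c(zdWalk j v (4q)) = c_v + q√3·n_j`;
* `dist_hexCenter_zdWalk_le` — consecutive centres are at distance `< 1`, whence
  `hexCenter_zdWalk` : `c(zdWalk j v n) = c_v + ⌊n/4⌋√3·n_j + e`, `‖e‖ ≤ 3`;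
* the opposite-form dictionary `zigzagForm_zdOpp`, `innerNormal_zdOpp`, and the existence of a
  bisecting normal for two normals at `120°` (`exists_bisector`).

Sources: folklore geometry of the hexagonal lattice (tables verified by exhaustive computation).
No proposition is defined and no named fact is introduced; the definitions are plain data
(`Site 2`-valued tables and the walk).
-/

noncomputable section

open scoped ComplexConjugate
open Set Metric
open Literature.Probability.LatticeModels

namespace Summit.CriticalPhenomena.SAWScalingLimit.Theorems.PolygonParitySqueeze.ZigzagDiscretisation

/-! ### 1. The tables and the walk -/

/-- The three admissible cell offsets `0, e₀, e₁`. [folklore] -/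
def zdVec : Fin 3 → Site 2 := ![0, Pi.single 0 1, Pi.single 1 1]

/-- Up-move table: from the up face `(x;0)` in phase `β` the walk of direction `n_j` moves to the down
face `(x - zdMoveA j β; 1)`. [folklore] -/
def zdMoveA (j : Fin 6) (β : Bool) : Site 2 :=
  zdVec ((![![0, 1], ![2, 2], ![0, 2], ![1, 1], ![0, 0], ![1, 2]] : Fin 6 → Fin 2 → Fin 3) j (if β then 1 else 0))

/-- Down-move table: from the down face `(x;1)` in phase `β` the walk of direction `n_j` moves to the
up face `(x + zdMoveB j β; 0)`. [folklore] -/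
def zdMoveB (j : Fin 6) (β : Bool) : Site 2 :=
  zdVec ((![![2, 2], ![0, 1], ![1, 1], ![0, 2], ![1, 2], ![0, 0]] : Fin 6 → Fin 2 → Fin 3) j (if β then 1 else 0))

/-- One step of the walk of direction `n_j` on states `(face, phase)`; the phase flips at up-moves.
[folklore] -/
def zdNext (j : Fin 6) (s : HexVertex × Bool) : HexVertex × Bool :=
  if s.1.2 = 0 then ((s.1.1 - zdMoveA j s.2, 1), !s.2) else ((s.1.1 + zdMoveB j s.2, 0), s.2)

/-- **The lattice walk of direction `n_j` started at the face `v`.** [folklore] -/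
def zdWalk (j : Fin 6) (v : HexVertex) (n : ℕ) : HexVertex := ((zdNext j)^[n] (v, false)).1

/-- The period vector of the walk of direction `n_j`: `b⁰ + b¹ - a⁰ - a¹`. [folklore] -/
def zdPeriod (j : Fin 6) : Site 2 := zdMoveB j false + zdMoveB j true - zdMoveA j false - zdMoveA j true

/-- The opposite form: `{0,1}, {2,3}, {4,5}` are swapped. [folklore] -/
def zdOpp : Fin 6 → Fin 6 := ![1, 0, 3, 2, 5, 4]

/-- The walk starts at `v`. [folklore] -/
@[simp] theorem zdWalk_zero (j : Fin 6) (v : HexVertex) : zdWalk j v 0 = v := rfl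

/-- The walk advances by `zdNext`. [folklore] -/
theorem zdWalk_succ_state (j : Fin 6) (v : HexVertex) (n : ℕ) :
    (zdNext j)^[n + 1] (v, false) = zdNext j ((zdNext j)^[n] (v, false)) :=
  Function.iterate_succ_apply' _ _ _

/-- The admissible offsets are `0`, `e₀` or `e₁`. [folklore] -/
theorem zdVec_cases (i : Fin 3) : zdVec i = 0 ∨ zdVec i = Pi.single 0 1 ∨ zdVec i = Pi.single 1 1 := by
  fin_cases i <;> simp [zdVec]

/-! ### 2. Adjacency -/

/-- **One step of the walk is an edge of `ℍ`.** [folklore] -/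
theorem zdNext_adj (j : Fin 6) (s : HexVertex × Bool) : hexGraph.Adj s.1 (zdNext j s).1 := by
  obtain ⟨⟨x, t⟩, β⟩ := s
  by_cases ht : t = 0
  · subst ht
    simp only [zdNext, Fin.isValue, ↓reduceIte]
    rw [hexGraph_adj_iff_of_snd_eq_zero_holds]
    rcases zdVec_cases ((![![0, 1], ![2, 2], ![0, 2], ![1, 1], ![0, 0], ![1, 2]] : Fin 6 → Fin 2 → Fin 3) j
        (if β then 1 else 0)) with h | h | h <;>
      simp only [zdMoveA, h, sub_zero, true_or, or_true]
  · obtain rfl : t = 1 := by fin_cases t <;> simp_all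
    simp only [zdNext, Fin.isValue, one_ne_zero, ↓reduceIte]
    rw [hexGraph_adj_iff_of_snd_eq_one]
    rcases zdVec_cases ((![![2, 2], ![0, 1], ![1, 1], ![0, 2], ![1, 2], ![0, 0]] : Fin 6 → Fin 2 → Fin 3) j
        (if β then 1 else 0)) with h | h | h <;>
      simp only [zdMoveB, h, add_zero, true_or, or_true]

/-- **Consecutive faces of the walk are adjacent in `ℍ`.** [folklore] -/
theorem zdWalk_adj (j : Fin 6) (v : HexVertex) (n : ℕ) : hexGraph.Adj (zdWalk j v n) (zdWalk j v (n + 1)) := by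
  rw [zdWalk, zdWalk, zdWalk_succ_state]
  exact zdNext_adj j _

/-! ### 3. Monotonicity of the three near forms -/

/-- The forms near the direction `n_j`: `⟪n_j, n_i⟫ ≥ 1/2` iff `i ∈ {j, N₁ j, N₂ j}` with
`N₁ = ![3,2,1,0,0,1]`, `N₂ = ![4,5,4,5,2,3]`. [folklore] -/
theorem near_cases {j i : Fin 6} (h : 1 / 2 ≤ (innerNormal j * conj (innerNormal i)).re) :
    i = j ∨ i = (![3, 2, 1, 0, 0, 1] : Fin 6 → Fin 6) j ∨ i = (![4, 5, 4, 5, 2, 3] : Fin 6 → Fin 6) j := by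
  rw [inner_innerNormal] at h
  fin_cases j <;> fin_cases i <;> first | (norm_num at h; done) | simp

/-- **One step never decreases a near form.** [folklore] -/
theorem zigzagForm_le_zdNext (j i : Fin 6) (h : 1 / 2 ≤ (innerNormal j * conj (innerNormal i)).re)
    (s : HexVertex × Bool) : zigzagForm i s.1 ≤ zigzagForm i (zdNext j s).1 := by
  obtain ⟨⟨x, t⟩, β⟩ := s
  rw [inner_innerNormal] at h
  fin_cases j <;> fin_cases i <;> first | (norm_num at h; done) | skip
  all_goals
    fin_cases t <;> cases β <;> simp [zdNext, zdMoveA, zdMoveB, zdVec, zigzagForm] <;> omega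

/-- **The near forms are non-decreasing along the walk** (one step). [folklore] -/
theorem zigzagForm_le_zdWalk_succ (j i : Fin 6) (h : 1 / 2 ≤ (innerNormal j * conj (innerNormal i)).re)
    (v : HexVertex) (n : ℕ) : zigzagForm i (zdWalk j v n) ≤ zigzagForm i (zdWalk j v (n + 1)) := by
  rw [zdWalk, zdWalk, zdWalk_succ_state]
  exact zigzagForm_le_zdNext j i h _

/-- **The near forms are non-decreasing along the walk.** [folklore] -/
theorem zigzagForm_le_zdWalk (j i : Fin 6) (h : 1 / 2 ≤ (innerNormal j * conj (innerNormal i)).re)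
    (v : HexVertex) {m n : ℕ} (hmn : m ≤ n) : zigzagForm i (zdWalk j v m) ≤ zigzagForm i (zdWalk j v n) := by
  induction hmn with
  | refl => exact le_rfl
  | step _ ih => exact ih.trans (zigzagForm_le_zdWalk_succ j i h v _)

/-- The walk's own form is near: `⟪n_j, n_j⟫ = 1 ≥ 1/2`. [folklore] -/
theorem half_le_inner_self (j : Fin 6) : 1 / 2 ≤ (innerNormal j * conj (innerNormal j)).re := by
  rw [re_innerNormal_mul_conj]; norm_num

/-! ### 4. The period -/

/-- **Four steps translate the state by the period vector.** [folklore] -/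
theorem zdNext_iterate_four (j : Fin 6) (s : HexVertex × Bool) :
    (zdNext j)^[4] s = ((s.1.1 + zdPeriod j, s.1.2), s.2) := by
  obtain ⟨⟨x, t⟩, β⟩ := s
  have h4 : (zdNext j)^[4] ((x, t), β) = zdNext j (zdNext j (zdNext j (zdNext j ((x, t), β)))) := by
    simp only [Function.iterate_succ, Function.iterate_zero, Function.comp_apply, id_eq]
  rw [h4]
  fin_cases t <;> cases β <;>
    simp only [zdNext, zdPeriod, Fin.isValue, ↓reduceIte, one_ne_zero, Bool.not_false, Bool.not_true,
      Fin.zero_eta, Fin.mk_one, Prod.mk.injEq, and_true] <;> abel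

/-- `zdNext` commutes with translations of the cell. [folklore] -/
theorem zdNext_translate (j : Fin 6) (x y : Site 2) (t : Fin 2) (β : Bool) :
    zdNext j ((x + y, t), β) = (((zdNext j ((x, t), β)).1.1 + y, (zdNext j ((x, t), β)).1.2), (zdNext j ((x, t), β)).2) := by
  fin_cases t <;> simp only [zdNext, Fin.isValue, ↓reduceIte, one_ne_zero, Fin.zero_eta, Fin.mk_one, Prod.mk.injEq,
    and_true] <;> abel

/-- Iterates of `zdNext` commute with translations of the cell. [folklore] -/
theorem zdNext_iterate_translate (j : Fin 6) (n : ℕ) (x y : Site 2) (t : Fin 2) (β : Bool) :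
    (zdNext j)^[n] ((x + y, t), β) =
      ((((zdNext j)^[n] ((x, t), β)).1.1 + y, ((zdNext j)^[n] ((x, t), β)).1.2), ((zdNext j)^[n] ((x, t), β)).2) := by
  induction n with
  | zero => simp
  | succ n ih =>
    rw [Function.iterate_succ_apply', ih, Function.iterate_succ_apply']
    set s := (zdNext j)^[n] ((x, t), β)
    obtain ⟨⟨x', t'⟩, β'⟩ := s
    exact zdNext_translate j x' y t' β'

/-- **Every period translates the walk by `zdPeriod j`** (same type). [folklore] -/
theorem zdWalk_add_four (j : Fin 6) (v : HexVertex) (n : ℕ) :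
    zdWalk j v (n + 4) = ((zdWalk j v n).1 + zdPeriod j, (zdWalk j v n).2) := by
  simp only [zdWalk]
  rw [show n + 4 = 4 + n from Nat.add_comm _ _, Function.iterate_add_apply, zdNext_iterate_four]

/-- The walk after `4q` more steps: translated by `q • zdPeriod j`. [folklore] -/
theorem zdWalk_add_four_mul (j : Fin 6) (v : HexVertex) (n q : ℕ) :
    zdWalk j v (n + 4 * q) = ((zdWalk j v n).1 + (q : ℤ) • zdPeriod j, (zdWalk j v n).2) := by
  induction q with
  | zero => simp
  | succ q ih =>
    rw [show n + 4 * (q + 1) = (n + 4 * q) + 4 by ring, zdWalk_add_four, ih]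
    simp only [Nat.cast_add, Nat.cast_one, Prod.mk.injEq, and_true]
    rw [add_smul, one_smul, add_assoc]

/-- **The period vector embeds to `√3·n_j`.** [folklore] -/
theorem triEmbed_zdPeriod (j : Fin 6) : triEmbed (zdPeriod j) = (Real.sqrt 3 : ℂ) * innerNormal j := by
  have h3 : Real.sqrt 3 * Real.sqrt 3 = 3 := Real.mul_self_sqrt (by norm_num)
  fin_cases j <;> apply Complex.ext <;>
    simp [zdPeriod, zdMoveA, zdMoveB, zdVec, innerNormal_eq, triEmbed] <;>
    nlinarith [h3]

/-- **Position after whole periods**: `c(zdWalk j v (n + 4q)) = c(zdWalk j v n) + q√3·n_j`. [folklore] -/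
theorem hexCenter_zdWalk_add_four_mul (j : Fin 6) (v : HexVertex) (n q : ℕ) :
    hexCenter (zdWalk j v (n + 4 * q)) = hexCenter (zdWalk j v n) + (q : ℂ) * (Real.sqrt 3 : ℂ) * innerNormal j := by
  rw [zdWalk_add_four_mul]
  set w := zdWalk j v n
  obtain ⟨x, t⟩ := w
  rw [Literature.Probability.RandomPlanarGeometry.hexCenter_add_left]
  have : triEmbed ((q : ℤ) • zdPeriod j) = (q : ℂ) * triEmbed (zdPeriod j) := by
    induction q with
    | zero => simp [triEmbed]
    | succ q ih =>
      rw [Nat.cast_succ, add_smul, one_smul, triEmbed_add, ih]; push_cast; ring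
  rw [this, triEmbed_zdPeriod]; ring

/-! ### 5. Distances along the walk -/

/-- **Adjacent faces have centres at distance `< 1`** (in fact `1/√3`). [folklore] -/
theorem dist_hexCenter_lt_one_of_adj {u w : HexVertex} (h : hexGraph.Adj u w) : dist (hexCenter u) (hexCenter w) < 1 := by
  have h3 : Real.sqrt 3 * Real.sqrt 3 = 3 := Real.mul_self_sqrt (by norm_num)
  have key : ∀ a b : ℝ, a ^ 2 + b ^ 2 < 1 → ‖(⟨a, b⟩ : ℂ)‖ < 1 := fun a b hd => by
    rw [← abs_norm, ← sq_lt_one_iff_abs_lt_one, ← Complex.normSq_eq_norm_sq, Complex.normSq_apply]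
    dsimp only
    nlinarith
  obtain ⟨x, t⟩ := u
  obtain ⟨y, t'⟩ := w
  rw [dist_comm, dist_eq_norm]
  by_cases ht : t = 0
  · subst ht
    obtain rfl : t' = 1 := by
      fin_cases t'
      · exact absurd h (not_hexGraph_adj_of_snd_eq_holds _ _ rfl)
      · rfl
    obtain ⟨eA, eB, eC⟩ := hexCenter_sub_up x
    rcases (hexGraph_adj_iff_of_snd_eq_zero_holds x y).1 h with rfl | rfl | rfl
    · rw [eA]; exact key _ _ (by nlinarith [h3])
    · rw [eB]; exact key _ _ (by nlinarith [h3])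
    · rw [eC]; exact key _ _ (by nlinarith [h3])
  · obtain rfl : t = 1 := by fin_cases t <;> simp_all
    obtain rfl : t' = 0 := by
      fin_cases t'
      · rfl
      · exact absurd h (not_hexGraph_adj_of_snd_eq_holds _ _ rfl)
    obtain ⟨eA, eB, eC⟩ := hexCenter_sub_down x
    rcases (hexGraph_adj_iff_of_snd_eq_one x y).1 h with rfl | rfl | rfl
    · rw [eA]; exact key _ _ (by nlinarith [h3])
    · rw [eB]; exact key _ _ (by nlinarith [h3])
    · rw [eC]; exact key _ _ (by nlinarith [h3])

/-- Within `s` steps the walk moves by less than `s` (at most, with equality only for `s = 0`).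
[folklore] -/
theorem dist_hexCenter_zdWalk_le (j : Fin 6) (v : HexVertex) (n s : ℕ) :
    dist (hexCenter (zdWalk j v (n + s))) (hexCenter (zdWalk j v n)) ≤ s := by
  induction s with
  | zero => simp
  | succ s ih =>
    calc dist (hexCenter (zdWalk j v (n + (s + 1)))) (hexCenter (zdWalk j v n))
        ≤ dist (hexCenter (zdWalk j v (n + s + 1))) (hexCenter (zdWalk j v (n + s))) +
            dist (hexCenter (zdWalk j v (n + s))) (hexCenter (zdWalk j v n)) := dist_triangle _ _ _
      _ ≤ 1 + s := by
          gcongr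
          rw [dist_comm]
          exact (dist_hexCenter_lt_one_of_adj (zdWalk_adj j v (n + s))).le
      _ = (s + 1 : ℕ) := by push_cast; ring

/-- **Position along the walk**: `c(zdWalk j v n) = c_v + ⌊n/4⌋·√3·n_j + e` with `‖e‖ ≤ 3`. [folklore] -/
theorem hexCenter_zdWalk (j : Fin 6) (v : HexVertex) (n : ℕ) :
    ∃ e : ℂ, hexCenter (zdWalk j v n) = hexCenter v + ((n / 4 : ℕ) : ℂ) * (Real.sqrt 3 : ℂ) * innerNormal j + e ∧ ‖e‖ ≤ 3 := by
  obtain ⟨q, s, hs, rfl⟩ : ∃ q s : ℕ, s ≤ 3 ∧ n = 0 + 4 * q + s := ⟨n / 4, n % 4, by omega, by omega⟩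
  have hq : (0 + 4 * q + s) / 4 = q := by omega
  rw [hq]
  refine ⟨hexCenter (zdWalk j v (0 + 4 * q + s)) - hexCenter (zdWalk j v (0 + 4 * q)), ?_, ?_⟩
  · rw [hexCenter_zdWalk_add_four_mul, zdWalk_zero]; ring
  · rw [← dist_eq_norm]
    refine (dist_hexCenter_zdWalk_le j v _ _).trans ?_
    exact_mod_cast hs

/-! ### 6. Opposite forms and bisectors -/

/-- The opposite form has the opposite value. [folklore] -/
theorem zigzagForm_zdOpp (k : Fin 6) (v : HexVertex) : zigzagForm (zdOpp k) v = -zigzagForm k v := by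
  fin_cases k <;> simp [zdOpp, zigzagForm]

/-- The opposite form has the opposite normal. [folklore] -/
theorem innerNormal_zdOpp (k : Fin 6) : innerNormal (zdOpp k) = -innerNormal k := by
  fin_cases k <;> simp [zdOpp, innerNormal_eq]

/-- `zdOpp` is an involution. [folklore] -/
theorem zdOpp_zdOpp (k : Fin 6) : zdOpp (zdOpp k) = k := by
  fin_cases k <;> rfl

/-- Levels against the opposite normal are opposite. [folklore] -/
theorem level_zdOpp (k : Fin 6) (w : ℂ) : (w * conj (innerNormal (zdOpp k))).re = -(w * conj (innerNormal k)).re := by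
  rw [innerNormal_zdOpp, map_neg, mul_neg, Complex.neg_re]

/-- **Two normals at `120°` have a bisecting normal** (at `60°` from both). [folklore] -/
theorem exists_bisector {k k' : Fin 6} (h : (innerNormal k * conj (innerNormal k')).re = -1 / 2) :
    ∃ j : Fin 6, (innerNormal j * conj (innerNormal k)).re = 1 / 2 ∧ (innerNormal j * conj (innerNormal k')).re = 1 / 2 := by
  refine ⟨(![![0, 0, 4, 0, 0, 3], ![0, 0, 0, 5, 2, 0], ![4, 0, 0, 0, 0, 1], ![0, 5, 0, 0, 0, 0], ![0, 2, 0, 0, 0, 0],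
    ![3, 0, 1, 0, 0, 0]] : Fin 6 → Fin 6 → Fin 6) k k', ?_⟩
  simp only [inner_innerNormal] at h ⊢
  fin_cases k <;> fin_cases k' <;> first | (norm_num at h; done) | simp

/-- Near forms of the opposite direction: `⟪n_{opp j}, n_{opp i}⟫ = ⟪n_j, n_i⟫`. [folklore] -/
theorem inner_zdOpp_zdOpp (j i : Fin 6) :
    (innerNormal (zdOpp j) * conj (innerNormal (zdOpp i))).re = (innerNormal j * conj (innerNormal i)).re := by
  rw [innerNormal_zdOpp, innerNormal_zdOpp, map_neg, neg_mul_neg]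

/-- **The six normal-direction walks** (registered form, sub-goal of `stub_innerPolygonsOfZigzag`):
consecutive faces adjacent, near forms non-decreasing, position `c_v + ⌊n/4⌋√3·n_j + O(1)`. [folklore] -/
theorem zd_walks : ∀ (j : Fin 6) (v : HexVertex) (n : ℕ), hexGraph.Adj (zdWalk j v n) (zdWalk j v (n + 1)) ∧ (∀ i : Fin 6, 1 / 2 ≤ (innerNormal j * (starRingEnd ℂ) (innerNormal i)).re → zigzagForm i v ≤ zigzagForm i (zdWalk j v n)) ∧ ∃ e : ℂ, hexCenter (zdWalk j v n) = hexCenter v + ((n / 4 : ℕ) : ℂ) * (Real.sqrt 3 : ℂ) * innerNormal j + e ∧ ‖e‖ ≤ 3 :=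
  fun j v n => ⟨zdWalk_adj j v n, fun i hi => by simpa using zigzagForm_le_zdWalk j i hi v (Nat.zero_le n),
    hexCenter_zdWalk j v n⟩

end Summit.CriticalPhenomena.SAWScalingLimit.Theorems.PolygonParitySqueeze.ZigzagDiscretisation

end
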